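import Summits.QuantumAdvantage.QuantumAdvantage.Theorems.CharDialJLinHybrid
import Summits.QuantumAdvantage.QuantumAdvantage.Theses.CharDial
import Summits.QuantumAdvantage.AdviceFreeQNC0.WalkHardFJuntaCuts
import Summits.QuantumAdvantage.AdviceFreeQNC0.LinearSelections
import HarnessLib

/-!
# Cell qa-qnc0 / decomp-qadv (odd primes): the EXCLUSIVE rung (proved) and the REDUCTION of CharDial's item 32604 / R5 to `L`-cores

TREE-READY PART 3/3 of the node `HOME/decomp-qadv-lens-6/g9/PeelDial.lean` (decomp-qadv-lens-6 g9, §4, §7–§10, §15),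
ZERO `def … : Prop` (core / exclusive / presentation hardness are spelled out in each statement).

* `data_of_core`, `pres_of_core`, **`pres_iff_core`** (`p ≠ 3`): item 32604 of route CharDial AT `p` — hardness of
  α's u-walk game against junta(`≤ log₂ n`) ⊕ ONE `𝔽_p`-linear-form cuts — is EQUIVALENT to hardness on `L`-CORES
  (`L = C'·log₂ n`, every `C'`): data in which NO active cut owns `≥ L` private bits.  (Peeling induction of part 1 +
  the proved one-step law of part 2 + `peel_error_small`.)
* **`exclusive_hard`** (`p ≠ 3`, UNCONDITIONAL): players in which every active cut owns `≥ C'·log₂ n` private bits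
  LOSE — a new rung outside the hypotheses of all four proved ceilings of the lineage (27290, 23022, 23108, 28072)
  and of the junta law; `witness`, `witness_isExclusive`, `witness_forms_ne`, `witness_odd_mem_readSet`,
  `witness_loses` certify this BY CONSTRUCTION (the family lies inside the declared residual class of crux 23109).
* BY NAME: `walkHardFLinSel_of_core` (R5 `WalkHardFLinSel p` from core hardness), **`charDial_walkHardFJLinOdd_iff_core`**
  (`CharDial.WalkHardFJLinOdd ↔ ∀ p ≥ 5, cores`), `charDial_frobHardOdd_of_core` (32598 ⟸ 32603 ∧ cores),
  `charDial_closes_of_core` (the leaf `AdviceFreeQNC0Odd` ⟸ 32603 ∧ cores ∧ 32599 ∧ 32600).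

WHAT THIS IS NOT: core hardness itself is OPEN (it contains mod-`p` counters — finite-state rung, proved for `p = 5` —,
sliding windows of width `> log₂ n`, nested chains and the dense generic VPE systems of 23109); nothing here touches
`DegLiftOdd` (32600) or `FrobLiftOdd` (32599); separation is not moved.
-/

noncomputable section

namespace Summit.QuantumAdvantage.AdviceFreeQNC0.JLinPeel

open Finset Summit.QuantumAdvantage.AdviceFreeQNC0 JLinData

/-! ### Presentation form (item 32604 at `p`, verbatim body) = data form -/
/-- Hardness over explicit DATA gives hardness against every strategy PRESENTED as junta(`≤ log₂ n`) ⊕ one form. -/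
theorem pres_of_data (p : ℕ) [Fact p.Prime]
    (h : ∃ θ : ℝ, θ < 1 ∧ ∃ n₀ : ℕ, ∀ n ≥ n₀, ∀ (c : ℕ) (D : JLinData p n),
      (∀ g, (D.J g).card ≤ Nat.log 2 n) → (winCount c D.strat : ℝ) ≤ θ * (2 : ℝ) ^ n) :
    ∃ θ : ℝ, θ < 1 ∧ ∃ n₀ : ℕ, ∀ n ≥ n₀, ∀ c : ℕ, ∀ y : Fin (n + 1) → (Fin n → Bool) → Bool,
      (∀ g, ∃ J : Finset (Fin n), J.card ≤ Nat.log 2 n ∧ ∃ a : Fin n → ZMod p, ∃ h : (Fin n → Bool) → ZMod p → Bool,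
          (∀ u v : Fin n → Bool, (∀ i ∈ J, u i = v i) → ∀ s, h u s = h v s) ∧
            ∀ u, y g u = h u (∑ i, if u i then a i else 0)) →
        ((Finset.univ.filter fun u : Fin n → Bool => ringWinU c y u = true).card : ℝ) ≤ θ * (2 : ℝ) ^ n := by
  obtain ⟨θ, hθ, n₀, hn₀⟩ := h
  refine ⟨θ, hθ, n₀, fun n hn c y hy => ?_⟩
  choose J hJ a h hdep hrep using hy
  let D : JLinData p n := ⟨J, a, h, fun g u v huv s => hdep g u v huv s⟩
  have hy' : y = D.strat := by
    funext g u
    exact hrep g u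
  have := hn₀ n hn c D hJ
  rw [hy']
  exact this
/-- … and conversely. -/
theorem data_of_pres (p : ℕ) [Fact p.Prime]
    (h : ∃ θ : ℝ, θ < 1 ∧ ∃ n₀ : ℕ, ∀ n ≥ n₀, ∀ c : ℕ, ∀ y : Fin (n + 1) → (Fin n → Bool) → Bool,
      (∀ g, ∃ J : Finset (Fin n), J.card ≤ Nat.log 2 n ∧ ∃ a : Fin n → ZMod p, ∃ h : (Fin n → Bool) → ZMod p → Bool,
          (∀ u v : Fin n → Bool, (∀ i ∈ J, u i = v i) → ∀ s, h u s = h v s) ∧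
            ∀ u, y g u = h u (∑ i, if u i then a i else 0)) →
        ((Finset.univ.filter fun u : Fin n → Bool => ringWinU c y u = true).card : ℝ) ≤ θ * (2 : ℝ) ^ n) :
    ∃ θ : ℝ, θ < 1 ∧ ∃ n₀ : ℕ, ∀ n ≥ n₀, ∀ (c : ℕ) (D : JLinData p n),
      (∀ g, (D.J g).card ≤ Nat.log 2 n) → (winCount c D.strat : ℝ) ≤ θ * (2 : ℝ) ^ n := by
  obtain ⟨θ, hθ, n₀, hn₀⟩ := h
  refine ⟨θ, hθ, n₀, fun n hn c D hJ => hn₀ n hn c D.strat fun g => ?_⟩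
  exact ⟨D.J g, hJ g, D.a g, D.h g, D.hJ g, fun u => rfl⟩

/-! ### The reduction to `L`-cores (law discharged by `hybrid_step`) -/
/-- **Core hardness ⟹ hardness** (`p ≠ 3`): if for every `C'` the `C'·log₂ n`-CORES (no active cut owns `≥ C'·log₂ n`
private bits) win at most `θ·2ⁿ`, then EVERY junta(`≤ log₂ n`) ⊕ form data does — peel (`peel_to_core`) with the proved
one-step law (`hybrid_step`), `≤ n + 1` peels of cost `C·ρ^{C' log₂ n}·2ⁿ` each (`peel_error_small`). -/
theorem data_of_core (p : ℕ) [Fact p.Prime] (hp3 : p ≠ 3)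
    (hC : ∀ C' : ℕ, ∃ θ : ℝ, θ < 1 ∧ ∃ n₀ : ℕ, ∀ n ≥ n₀, ∀ (c : ℕ) (D : JLinData p n),
      (∀ g, (D.J g).card ≤ Nat.log 2 n) → (∀ g, (D.suppForm g).Nonempty → D.priv g < C' * Nat.log 2 n) →
        (winCount c D.strat : ℝ) ≤ θ * (2 : ℝ) ^ n) :
    ∃ θ : ℝ, θ < 1 ∧ ∃ n₀ : ℕ, ∀ n ≥ n₀, ∀ (c : ℕ) (D : JLinData p n),
      (∀ g, (D.J g).card ≤ Nat.log 2 n) → (winCount c D.strat : ℝ) ≤ θ * (2 : ℝ) ^ n := by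
  obtain ⟨C, ρ, hC0, hρ0, hρ1, hstep⟩ := hybrid_step p hp3
  obtain ⟨C', hC'⟩ := exists_pow_lt_of_lt_one (show (0 : ℝ) < 1 / 4 by norm_num) hρ1
  obtain ⟨θ₁, hθ₁, n₀, hn₀⟩ := hC C'
  obtain ⟨n₁, hn₁⟩ := peel_error_small C ((1 - θ₁) / 2) (ρ ^ C') hC0 (by linarith) (pow_nonneg hρ0 _) hC'.le
  refine ⟨(1 + θ₁) / 2, by linarith, max n₀ n₁, fun n hn c D hJ => ?_⟩
  have hpeel := peel_to_core (p := p) (n := n) c hC0 hρ0 hρ1.le (fun D g => hstep n c D g) (C' * Nat.log 2 n)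
    (Nat.log 2 n) θ₁ (fun D' hJ' hc' => hn₀ n (le_of_max_le_left hn) c D' hJ' hc') (n + 1) D hJ
    (card_activeSet_le D)
  have herr := hn₁ n (le_of_max_le_right hn)
  rw [← pow_mul] at herr
  have h2n : (0 : ℝ) < (2 : ℝ) ^ n := by positivity
  have hcast : (((n + 1 : ℕ) : ℝ)) = (n : ℝ) + 1 := by push_cast; ring
  rw [hcast] at hpeel
  nlinarith
/-- **Item 32604 at `p` ⟸ core hardness** (`p ≠ 3`). -/
theorem pres_of_core (p : ℕ) [Fact p.Prime] (hp3 : p ≠ 3)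
    (hC : ∀ C' : ℕ, ∃ θ : ℝ, θ < 1 ∧ ∃ n₀ : ℕ, ∀ n ≥ n₀, ∀ (c : ℕ) (D : JLinData p n),
      (∀ g, (D.J g).card ≤ Nat.log 2 n) → (∀ g, (D.suppForm g).Nonempty → D.priv g < C' * Nat.log 2 n) →
        (winCount c D.strat : ℝ) ≤ θ * (2 : ℝ) ^ n) :
    ∃ θ : ℝ, θ < 1 ∧ ∃ n₀ : ℕ, ∀ n ≥ n₀, ∀ c : ℕ, ∀ y : Fin (n + 1) → (Fin n → Bool) → Bool,
      (∀ g, ∃ J : Finset (Fin n), J.card ≤ Nat.log 2 n ∧ ∃ a : Fin n → ZMod p, ∃ h : (Fin n → Bool) → ZMod p → Bool,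
          (∀ u v : Fin n → Bool, (∀ i ∈ J, u i = v i) → ∀ s, h u s = h v s) ∧
            ∀ u, y g u = h u (∑ i, if u i then a i else 0)) →
        ((Finset.univ.filter fun u : Fin n → Bool => ringWinU c y u = true).card : ℝ) ≤ θ * (2 : ℝ) ^ n :=
  pres_of_data p (data_of_core p hp3 hC)
/-- The converse is trivial: a core is in particular a junta ⊕ form player. -/
theorem core_of_pres (p : ℕ) [Fact p.Prime]
    (h : ∃ θ : ℝ, θ < 1 ∧ ∃ n₀ : ℕ, ∀ n ≥ n₀, ∀ c : ℕ, ∀ y : Fin (n + 1) → (Fin n → Bool) → Bool,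
      (∀ g, ∃ J : Finset (Fin n), J.card ≤ Nat.log 2 n ∧ ∃ a : Fin n → ZMod p, ∃ h : (Fin n → Bool) → ZMod p → Bool,
          (∀ u v : Fin n → Bool, (∀ i ∈ J, u i = v i) → ∀ s, h u s = h v s) ∧
            ∀ u, y g u = h u (∑ i, if u i then a i else 0)) →
        ((Finset.univ.filter fun u : Fin n → Bool => ringWinU c y u = true).card : ℝ) ≤ θ * (2 : ℝ) ^ n) :
    ∀ C' : ℕ, ∃ θ : ℝ, θ < 1 ∧ ∃ n₀ : ℕ, ∀ n ≥ n₀, ∀ (c : ℕ) (D : JLinData p n),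
      (∀ g, (D.J g).card ≤ Nat.log 2 n) → (∀ g, (D.suppForm g).Nonempty → D.priv g < C' * Nat.log 2 n) →
        (winCount c D.strat : ℝ) ≤ θ * (2 : ℝ) ^ n := by
  obtain ⟨θ, hθ, n₀, hn₀⟩ := data_of_pres p h
  exact fun _ => ⟨θ, hθ, n₀, fun n hn c D hJ _ => hn₀ n hn c D hJ⟩
/-- **Item 32604 at `p` ⟺ hardness on `L`-cores** (`p ≠ 3`; PROVED REDUCTION). -/
theorem pres_iff_core (p : ℕ) [Fact p.Prime] (hp3 : p ≠ 3) :
    (∃ θ : ℝ, θ < 1 ∧ ∃ n₀ : ℕ, ∀ n ≥ n₀, ∀ c : ℕ, ∀ y : Fin (n + 1) → (Fin n → Bool) → Bool,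
      (∀ g, ∃ J : Finset (Fin n), J.card ≤ Nat.log 2 n ∧ ∃ a : Fin n → ZMod p, ∃ h : (Fin n → Bool) → ZMod p → Bool,
          (∀ u v : Fin n → Bool, (∀ i ∈ J, u i = v i) → ∀ s, h u s = h v s) ∧
            ∀ u, y g u = h u (∑ i, if u i then a i else 0)) →
        ((Finset.univ.filter fun u : Fin n → Bool => ringWinU c y u = true).card : ℝ) ≤ θ * (2 : ℝ) ^ n) ↔
    (∀ C' : ℕ, ∃ θ : ℝ, θ < 1 ∧ ∃ n₀ : ℕ, ∀ n ≥ n₀, ∀ (c : ℕ) (D : JLinData p n),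
      (∀ g, (D.J g).card ≤ Nat.log 2 n) → (∀ g, (D.suppForm g).Nonempty → D.priv g < C' * Nat.log 2 n) →
        (winCount c D.strat : ℝ) ≤ θ * (2 : ℝ) ^ n) :=
  ⟨core_of_pres p, pres_of_core p hp3⟩

/-! ### The EXCLUSIVE rung is a THEOREM (junta base from the tree's `walkHardFJuntaCuts`) -/
/-- A totally inactive data with juntas `≤ log₂ n` is a `(log₂ n)^1`-junta strategy: the tree's `walkHardFJuntaCuts` applies. -/
theorem win_le_of_inactive (p : ℕ) [Fact p.Prime] {θ : ℝ} {n₀ : ℕ}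
    (hJθ : ∀ n ≥ n₀, ∀ c : ℕ, ∀ y : Fin (n + 1) → (Fin n → Bool) → Bool,
      (∀ g, ∃ J : Finset (Fin n), J.card ≤ (Nat.log 2 n) ^ 1 ∧
          ∀ u v : Fin n → Bool, (∀ i ∈ J, u i = v i) → y g u = y g v) →
        ((Finset.univ.filter fun u : Fin n → Bool => ringWinU c y u = true).card : ℝ) ≤ θ * (2 : ℝ) ^ n)
    {n : ℕ} (hn : n₀ ≤ n) (c : ℕ) (D : JLinData p n) (hJ : (∀ g, (D.J g).card ≤ (Nat.log 2 n))) (h0 : D.activeSet = ∅) :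
    (winCount c D.strat : ℝ) ≤ θ * (2 : ℝ) ^ n :=
  hJθ n hn c D.strat fun g => ⟨D.J g, by rw [pow_one]; exact hJ g,
    fun u v huv => strat_dependsOn_of_inactive D h0 g u v huv⟩
/-- **The exclusive rung, UNCONDITIONALLY** (`p ≠ 3`): for some constant `C'`, junta(`≤ log₂ n`) ⊕ form players in which
every ACTIVE cut owns `≥ C'·log₂ n` PRIVATE bits lose α's u-walk game (`θ < 1` uniform).  A new rung of the X-form
lineage: outside the hypotheses of `LinFormsSqrtOdd` (27290), `ShotsSqrtOdd` (23022), `FewReadersOdd` (23108), the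
finite-state rung (28072) and the junta law, by the witness family below. -/
theorem exclusive_hard (p : ℕ) [Fact p.Prime] (hp3 : p ≠ 3) :
    ∃ C' : ℕ, ∃ θ : ℝ, θ < 1 ∧ ∃ n₀ : ℕ, ∀ n ≥ n₀, ∀ (c : ℕ) (D : JLinData p n),
      (∀ g, (D.J g).card ≤ Nat.log 2 n) → (∀ g, (D.suppForm g).Nonempty → C' * Nat.log 2 n ≤ D.priv g) →
        (winCount c D.strat : ℝ) ≤ θ * (2 : ℝ) ^ n := by
  obtain ⟨C, ρ, hC0, hρ0, hρ1, hstep⟩ := hybrid_step p hp3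
  obtain ⟨C', hC'⟩ := exists_pow_lt_of_lt_one (show (0 : ℝ) < 1 / 4 by norm_num) hρ1
  obtain ⟨θJ, hθJ, hJall⟩ := walkHardFJuntaCuts p hp3
  obtain ⟨n₀, hn₀⟩ := hJall 1
  obtain ⟨n₁, hn₁⟩ := peel_error_small C ((1 - θJ) / 2) (ρ ^ C') hC0 (by linarith) (pow_nonneg hρ0 _) hC'.le
  refine ⟨C', (1 + θJ) / 2, by linarith, max n₀ n₁, fun n hn c D hJ hex => ?_⟩
  have hpeel := peel_exclusive (p := p) (n := n) c hC0 hρ0 hρ1.le (fun D g => hstep n c D g) (C' * Nat.log 2 n)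
    (Nat.log 2 n) θJ (fun D' hJ' h0 => win_le_of_inactive p hn₀ (le_of_max_le_left hn) c D' hJ' h0) (n + 1) D hJ hex
    (card_activeSet_le D)
  have herr := hn₁ n (le_of_max_le_right hn)
  rw [← pow_mul] at herr
  have h2n : (0 : ℝ) < (2 : ℝ) ^ n := by positivity
  have hcast : (((n + 1 : ℕ) : ℝ)) = (n : ℝ) + 1 := by push_cast; ring
  rw [hcast] at hpeel
  nlinarith
/-- The exclusive rung is (trivially) implied by item 32604 at `p`. -/
theorem exclusive_of_pres (p : ℕ) [Fact p.Prime]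
    (h : ∃ θ : ℝ, θ < 1 ∧ ∃ n₀ : ℕ, ∀ n ≥ n₀, ∀ c : ℕ, ∀ y : Fin (n + 1) → (Fin n → Bool) → Bool,
      (∀ g, ∃ J : Finset (Fin n), J.card ≤ Nat.log 2 n ∧ ∃ a : Fin n → ZMod p, ∃ h : (Fin n → Bool) → ZMod p → Bool,
          (∀ u v : Fin n → Bool, (∀ i ∈ J, u i = v i) → ∀ s, h u s = h v s) ∧
            ∀ u, y g u = h u (∑ i, if u i then a i else 0)) →
        ((Finset.univ.filter fun u : Fin n → Bool => ringWinU c y u = true).card : ℝ) ≤ θ * (2 : ℝ) ^ n) :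
    ∃ C' : ℕ, ∃ θ : ℝ, θ < 1 ∧ ∃ n₀ : ℕ, ∀ n ≥ n₀, ∀ (c : ℕ) (D : JLinData p n),
      (∀ g, (D.J g).card ≤ Nat.log 2 n) → (∀ g, (D.suppForm g).Nonempty → C' * Nat.log 2 n ≤ D.priv g) →
        (winCount c D.strat : ℝ) ≤ θ * (2 : ℝ) ^ n := by
  obtain ⟨θ, hθ, n₀, hn₀⟩ := data_of_pres p h
  exact ⟨1, θ, hθ, n₀, fun n hn c D hJ _ => hn₀ n hn c D hJ⟩

/-! ### Deciding theorems BY NAME: R5 `WalkHardFLinSel p`, CharDial's 32604 `WalkHardFJLinOdd`, 32598 `FrobHardOdd`, the leaf -/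
/-- R5 (tree `WalkHardFLinSel p`) is contained in item 32604 at `p` (junta `∅`, table `[s = r]`). -/
theorem walkHardFLinSel_of_pres (p : ℕ) [Fact p.Prime]
    (h : ∃ θ : ℝ, θ < 1 ∧ ∃ n₀ : ℕ, ∀ n ≥ n₀, ∀ c : ℕ, ∀ y : Fin (n + 1) → (Fin n → Bool) → Bool,
      (∀ g, ∃ J : Finset (Fin n), J.card ≤ Nat.log 2 n ∧ ∃ a : Fin n → ZMod p, ∃ h : (Fin n → Bool) → ZMod p → Bool,
          (∀ u v : Fin n → Bool, (∀ i ∈ J, u i = v i) → ∀ s, h u s = h v s) ∧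
            ∀ u, y g u = h u (∑ i, if u i then a i else 0)) →
        ((Finset.univ.filter fun u : Fin n → Bool => ringWinU c y u = true).card : ℝ) ≤ θ * (2 : ℝ) ^ n) :
    WalkHardFLinSel p := by
  obtain ⟨θ, hθ, n₀, hn₀⟩ := h
  refine ⟨θ, hθ, n₀, fun n hn c y hy => hn₀ n hn c y fun g => ?_⟩
  obtain ⟨ℓ, r, hℓ⟩ := hy g
  exact ⟨∅, by simp, ℓ, fun _ s => decide (s = r), fun _ _ _ _ => rfl, fun u => hℓ u⟩
/-- **R5 ⟸ core hardness** (`p ≠ 3`). -/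
theorem walkHardFLinSel_of_core (p : ℕ) [Fact p.Prime] (hp3 : p ≠ 3)
    (hC : ∀ C' : ℕ, ∃ θ : ℝ, θ < 1 ∧ ∃ n₀ : ℕ, ∀ n ≥ n₀, ∀ (c : ℕ) (D : JLinData p n),
      (∀ g, (D.J g).card ≤ Nat.log 2 n) → (∀ g, (D.suppForm g).Nonempty → D.priv g < C' * Nat.log 2 n) →
        (winCount c D.strat : ℝ) ≤ θ * (2 : ℝ) ^ n) :
    WalkHardFLinSel p :=
  walkHardFLinSel_of_pres p (pres_of_core p hp3 hC)

/-- **CharDial item 32604 ⟺ core hardness at every prime `p ≥ 5`** (PROVED REDUCTION of the route's many-tests core). -/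
theorem charDial_walkHardFJLinOdd_iff_core :
    Summit.QuantumAdvantage.QuantumAdvantage.Theses.CharDial.WalkHardFJLinOdd ↔ ∀ (p : ℕ) [Fact p.Prime], 5 ≤ p →
      ∀ C' : ℕ, ∃ θ : ℝ, θ < 1 ∧ ∃ n₀ : ℕ, ∀ n ≥ n₀, ∀ (c : ℕ) (D : JLinData p n),
      (∀ g, (D.J g).card ≤ Nat.log 2 n) → (∀ g, (D.suppForm g).Nonempty → D.priv g < C' * Nat.log 2 n) →
        (winCount c D.strat : ℝ) ≤ θ * (2 : ℝ) ^ n :=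
  ⟨fun h p _ hp => core_of_pres p (h p hp), fun hC p _ hp => pres_of_core p (by omega) (hC p hp)⟩

/-- **CharDial item 32604 ⟸ core hardness** (the `→` half, in `closes` shape). -/
theorem charDial_walkHardFJLinOdd_of_core
    (hC : ∀ (p : ℕ) [Fact p.Prime], 5 ≤ p →
      ∀ C' : ℕ, ∃ θ : ℝ, θ < 1 ∧ ∃ n₀ : ℕ, ∀ n ≥ n₀, ∀ (c : ℕ) (D : JLinData p n),
      (∀ g, (D.J g).card ≤ Nat.log 2 n) → (∀ g, (D.suppForm g).Nonempty → D.priv g < C' * Nat.log 2 n) →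
        (winCount c D.strat : ℝ) ≤ θ * (2 : ℝ) ^ n) :
    Summit.QuantumAdvantage.QuantumAdvantage.Theses.CharDial.WalkHardFJLinOdd :=
  charDial_walkHardFJLinOdd_iff_core.2 hC

/-- **CharDial's rank-2 crux `FrobHardOdd` (32598) ⟸ `FrobStructureLaw` (32603) ∧ core hardness** (the law gives
junta(`J₀`) ⊕ form presentations, `J₀ ≤ log₂ n` once `n ≥ 2^{J₀}`). -/
theorem charDial_frobHardOdd_of_core (hL : Summit.QuantumAdvantage.QuantumAdvantage.Theses.CharDial.FrobStructureLaw)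
    (hC : ∀ (p : ℕ) [Fact p.Prime], 5 ≤ p →
      ∀ C' : ℕ, ∃ θ : ℝ, θ < 1 ∧ ∃ n₀ : ℕ, ∀ n ≥ n₀, ∀ (c : ℕ) (D : JLinData p n),
      (∀ g, (D.J g).card ≤ Nat.log 2 n) → (∀ g, (D.suppForm g).Nonempty → D.priv g < C' * Nat.log 2 n) →
        (winCount c D.strat : ℝ) ≤ θ * (2 : ℝ) ^ n) :
    Summit.QuantumAdvantage.QuantumAdvantage.Theses.CharDial.FrobHardOdd := by
  intro p _ hp
  obtain ⟨J₀, hJ₀⟩ := hL p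
  obtain ⟨θ, hθ, n₀, hn₀⟩ := pres_of_core p (by omega) (hC p hp)
  refine ⟨θ, hθ, max n₀ (2 ^ J₀), fun n hn c y hy => hn₀ n (le_trans (le_max_left _ _) hn) c y fun g => ?_⟩
  obtain ⟨J, hJc, a, h, hdep, hrep⟩ := hJ₀ n (y g) (hy g)
  have hd' : J₀ ≤ Nat.log 2 n := Nat.le_log_of_pow_le (by norm_num) (le_trans (le_max_right _ _) hn)
  exact ⟨J, hJc.trans hd', a, h, hdep, hrep⟩

/-- **CharDial's leaf from `FrobStructureLaw` (32603), core hardness, `FrobLiftOdd` (32599), `DegLiftOdd` (32600).** -/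
theorem charDial_closes_of_core (hL : Summit.QuantumAdvantage.QuantumAdvantage.Theses.CharDial.FrobStructureLaw)
    (hC : ∀ (p : ℕ) [Fact p.Prime], 5 ≤ p →
      ∀ C' : ℕ, ∃ θ : ℝ, θ < 1 ∧ ∃ n₀ : ℕ, ∀ n ≥ n₀, ∀ (c : ℕ) (D : JLinData p n),
      (∀ g, (D.J g).card ≤ Nat.log 2 n) → (∀ g, (D.suppForm g).Nonempty → D.priv g < C' * Nat.log 2 n) →
        (winCount c D.strat : ℝ) ≤ θ * (2 : ℝ) ^ n)
    (hLift : Summit.QuantumAdvantage.QuantumAdvantage.Theses.CharDial.FrobLiftOdd) (hD : Summit.QuantumAdvantage.QuantumAdvantage.Theses.CharDial.DegLiftOdd) :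
    Summit.QuantumAdvantage.AdviceFreeQNC0.AdviceFreeQNC0Odd :=
  Summit.QuantumAdvantage.QuantumAdvantage.Theses.CharDial.closes (charDial_frobHardOdd_of_core hL hC) hLift hD

/-! ### The witness family of the exclusive rung (non-empty, beyond every proved ceiling BY CONSTRUCTION)

`n = 2Lm`; cut `g < m` has junta `∅`, table `[s = 0]`, and form `Σ_{i even, i ∈ block g} u_i + Σ_{i odd} u_i`
(block `g` = positions `[2Lg, 2L(g+1))`); cuts `g ≥ m` are silent.  `witness_isExclusive`: `L`-exclusive;
`witness_forms_ne`: pairwise distinct forms (rank `m = n/2L ≫ √n`); `witness_odd_mem_readSet`: every odd position (so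
every ADJACENT pair) is read by all `m` cuts — inside the residual class of OddPrimeWalk's crux 23109; `witness_loses`:
they lose, unconditionally. -/

section Witness

variable (p : ℕ)

/-- Coefficients of the witness family: cut `g < m` reads all odd positions and the even positions of block `g`. -/
def witnessA (L m : ℕ) (g : Fin (2 * L * m + 1)) (i : Fin (2 * L * m)) : ZMod p :=
  if g.val < m ∧ (i.val % 2 = 1 ∨ (i.val % 2 = 0 ∧ i.val / (2 * L) = g.val)) then 1 else 0

/-- The witness data (junta-free linear tests `[ℓ_g(u) = 0]` for `g < m`, silent cuts for `g ≥ m`). -/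
def witness (L m : ℕ) : JLinData p (2 * L * m) where
  J := fun _ => ∅
  a := witnessA p L m
  h := fun g _ s => decide (g.val < m ∧ s = 0)
  hJ := fun _ _ _ _ _ => rfl

variable {p}

/-- CharDial sub-characteristic helper `witness_juntaBound` (lens-6 g8 LAND package; see the module docstring). -/
theorem witness_juntaBound (L m : ℕ) : ∀ g, ((witness p L m).J g).card ≤ 0 := fun g => by
  show (∅ : Finset (Fin (2 * L * m))).card ≤ 0
  simp

/-- The `t`-th private position of block `g`: `2Lg + 2t`. -/
theorem witness_pos_lt {L m : ℕ} {g : Fin (2 * L * m + 1)} (hg : g.val < m) (t : Fin L) :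
    2 * L * g.val + 2 * t.val < 2 * L * m := by
  have ht := t.isLt
  have h1 : 2 * L * g.val + 2 * t.val < 2 * L * (g.val + 1) := by nlinarith
  have h2 : 2 * L * (g.val + 1) ≤ 2 * L * m := Nat.mul_le_mul_left _ hg
  omega

/-- An active cut of the witness has index `< m`. -/
theorem witness_lt_of_active [Fact p.Prime] {L m : ℕ} {g : Fin (2 * L * m + 1)}
    (hg : ((witness p L m).suppForm g).Nonempty) : g.val < m := by
  by_contra hlt
  obtain ⟨i, hi⟩ := hg
  unfold JLinData.suppForm witness witnessA at hi
  simp only [mem_filter, mem_univ, true_and] at hi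
  exact hi (by rw [if_neg (fun h => hlt h.1)])

/-- **The witness is `L`-exclusive**: every active cut owns the `L` even positions of its block. -/
theorem witness_isExclusive [Fact p.Prime] (L m : ℕ) :
    ∀ g, ((witness p L m).suppForm g).Nonempty → L ≤ (witness p L m).priv g := by
  intro g hg
  have hgm : g.val < m := witness_lt_of_active hg
  have hL0 : 0 < 2 * L := by
    rcases Nat.eq_zero_or_pos L with h | h
    · subst h
      obtain ⟨i, _⟩ := hg
      exact absurd i.isLt (by simp)
    · omega
  -- the injection `t ↦ 2Lg + 2t` into the private set
  let f : Fin L → Fin (2 * L * m) := fun t => ⟨2 * L * g.val + 2 * t.val, witness_pos_lt hgm t⟩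
  have hf : Function.Injective f := by
    intro t t' h
    have := congrArg Fin.val h
    simp only [f] at this
    exact Fin.ext (by omega)
  have hdiv : ∀ t : Fin L, (2 * L * g.val + 2 * t.val) / (2 * L) = g.val := fun t => by
    rw [Nat.mul_add_div hL0, Nat.div_eq_of_lt (by have := t.isLt; omega), add_zero]
  have hmod : ∀ t : Fin L, (2 * L * g.val + 2 * t.val) % 2 = 0 := fun t => by
    rw [show 2 * L * g.val + 2 * t.val = 2 * (L * g.val + t.val) by ring]
    exact Nat.mul_mod_right 2 _
  have hone : (1 : ZMod p) ≠ 0 := one_ne_zero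
  have hsub : (univ.image f) ⊆ (witness p L m).privSet g := by
    intro i hi
    obtain ⟨t, _, rfl⟩ := mem_image.1 hi
    unfold JLinData.privSet JLinData.readSet JLinData.suppForm
    simp only [mem_filter, mem_univ, true_and, mem_union, not_or]
    refine ⟨?_, ?_, fun g' hg' => ⟨?_, ?_⟩⟩
    · -- in the support of `g`
      show witnessA p L m g (f t) ≠ 0
      unfold witnessA
      rw [if_pos ⟨hgm, Or.inr ⟨hmod t, hdiv t⟩⟩]
      exact hone
    · show f t ∉ (∅ : Finset (Fin (2 * L * m)))
      simp
    · show f t ∉ (∅ : Finset (Fin (2 * L * m)))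
      simp
    · -- not in the support of any other cut
      show ¬ (witnessA p L m g' (f t) ≠ 0)
      rw [not_not]
      unfold witnessA
      rw [if_neg]
      rintro ⟨_, h | h⟩
      · have h' : (2 * L * g.val + 2 * t.val) % 2 = 1 := h
        rw [hmod t] at h'
        exact absurd h' (by norm_num)
      · exact hg' (Fin.ext ((hdiv t).symm.trans h.2).symm)
  calc L = (univ.image f).card := by rw [card_image_of_injective _ hf]; simp
    _ ≤ ((witness p L m).privSet g).card := card_le_card hsub

/-- Every active cut of the witness reads EVERY odd position (so every adjacent bit pair is read by all `m` active cuts: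
the family lies outside the hypothesis of R8 `FewReadersOdd`, i.e. inside the residual class of OddPrimeWalk's crux 23109). -/
theorem witness_odd_mem_readSet [Fact p.Prime] {L m : ℕ} {g : Fin (2 * L * m + 1)} (hg : g.val < m)
    (i : Fin (2 * L * m)) (hi : i.val % 2 = 1) : i ∈ (witness p L m).readSet g := by
  unfold JLinData.readSet JLinData.suppForm
  simp only [mem_union, mem_filter, mem_univ, true_and]
  right
  show witnessA p L m g i ≠ 0
  unfold witnessA
  rw [if_pos ⟨hg, Or.inl hi⟩]
  exact one_ne_zero

/-- Every cut `g < m` of the witness is active (for `L ≥ 1`). -/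
theorem witness_active [Fact p.Prime] {L m : ℕ} (hL : 0 < L) {g : Fin (2 * L * m + 1)} (hg : g.val < m) :
    ((witness p L m).suppForm g).Nonempty := by
  have hL0 : 0 < 2 * L := by omega
  refine ⟨⟨2 * L * g.val + 2 * 0, witness_pos_lt hg ⟨0, hL⟩⟩, ?_⟩
  unfold JLinData.suppForm
  simp only [mem_filter, mem_univ, true_and]
  show witnessA p L m g _ ≠ 0
  unfold witnessA
  have hmod : (2 * L * g.val + 2 * 0) % 2 = 0 := by
    rw [Nat.mul_zero, Nat.add_zero, Nat.mul_assoc]; exact Nat.mul_mod_right 2 _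
  rw [if_pos ⟨hg, Or.inr ⟨hmod, by rw [Nat.mul_add_div hL0]; simp⟩⟩]
  exact one_ne_zero

/-- The forms of two distinct active cuts of the witness DIFFER (so the family has `m` pairwise distinct forms: rank and
number of distinct tests `m = n/(2L)`, far above the `√n` ceilings for `L = C'·log₂ n`). -/
theorem witness_forms_ne [Fact p.Prime] {L m : ℕ} (hL : 0 < L) {g g' : Fin (2 * L * m + 1)} (hg : g.val < m)
    (hne : g ≠ g') : (witness p L m).a g ≠ (witness p L m).a g' := by
  intro h
  have hL0 : 0 < 2 * L := by omega
  have hdiv : (2 * L * g.val + 2 * 0) / (2 * L) = g.val := by rw [Nat.mul_add_div hL0]; simp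
  have := congrFun h ⟨2 * L * g.val + 2 * 0, witness_pos_lt hg ⟨0, hL⟩⟩
  change witnessA p L m g _ = witnessA p L m g' _ at this
  unfold witnessA at this
  have hmod : (2 * L * g.val + 2 * 0) % 2 = 0 := by
    rw [Nat.mul_zero, Nat.add_zero, Nat.mul_assoc]; exact Nat.mul_mod_right 2 _
  rw [if_pos ⟨hg, Or.inr ⟨hmod, hdiv⟩⟩, if_neg] at this
  · exact one_ne_zero this
  · rintro ⟨_, h1 | h1⟩
    · have h1' : (2 * L * g.val + 2 * 0) % 2 = 1 := h1
      rw [hmod] at h1'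
      exact absurd h1' (by norm_num)
    · exact hne (Fin.ext (hdiv.symm.trans h1.2))

/-- **The rung in action** (UNCONDITIONAL, `p ≠ 3`): witness-family members with block length `L ≥ C'·log₂ n` lose the game
(an instance of `exclusive_hard`; no previously proved rung of the lineage covers them). -/
theorem witness_loses [Fact p.Prime] (hp3 : p ≠ 3) :
    ∃ C' : ℕ, ∃ θ : ℝ, θ < 1 ∧ ∃ n₀ : ℕ, ∀ L m : ℕ, n₀ ≤ 2 * L * m → C' * Nat.log 2 (2 * L * m) ≤ L → ∀ c : ℕ,
      (winCount c (witness p L m).strat : ℝ) ≤ θ * (2 : ℝ) ^ (2 * L * m) := by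
  obtain ⟨C', θ, hθ, n₀, hn₀⟩ := exclusive_hard p hp3
  refine ⟨C', θ, hθ, n₀, fun L m hn hL c => hn₀ _ hn c _ (fun g => ?_) fun g hg => hL.trans (witness_isExclusive L m g hg)⟩
  show (∅ : Finset (Fin (2 * L * m))).card ≤ _
  simp


end Witness

end Summit.QuantumAdvantage.AdviceFreeQNC0.JLinPeel

end
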